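import Mathlib
import Summits.AtomisticToContinuum.FouriersLaw.Theses.EmbeddedDrudeMourre
import Literature.MathematicalPhysics.KineticTheory.ZeroWavenumberSpace
import Literature.MathematicalPhysics.KineticTheory.InfiniteChainSuperstableDynamics
import Summits.AtomisticToContinuum.FouriersLaw.Theorems.EmbeddedDrudeMourreMourreDissolutionCosineBochner
import Summits.AtomisticToContinuum.FouriersLaw.Theorems.EmbeddedDrudeMourreMourreDissolutionPoissonWindowInversion
import HarnessLib

/-!
# `EmbeddedDrudeMourre.MourreDissolution`, line `separable-vertex-faddeev-pair-sector` —
# helper for stub `stub_fgrPositivity` (S7): a Cesàro floor implies the Abel floor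

Item `stmt-AtomisticToContinuum-12594` (crux `MourreDissolution` of route `EmbeddedDrudeMourre`,
sub-problem `FouriersLaw`), registered stub `stub_fgrPositivity` (S7) of the line skeleton
`Cruxes/MourreDissolution/Lines/separable_vertex_faddeev_pair_sector.lean`:

  (S7) for `ω₂ lam β γ > 0` under `HasOddSectorGap ω₂ lam β` there is `T₀ > 0` such that for
  `T ∈ (0, T₀)` and every regular Θ-symmetric zero-wavenumber framework `(D, Z)` of
  `pinnedChain ω₂ lam β γ` at temperature `T` (BM carrier, DLR Gibbs, superstable, momentum
  reversal, strongly continuous Koopman group) the Abel means of the summed current autocorrelation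
  `C_T = D.currentCorrelation Z.μ` are uniformly bounded below,
  `∃ c ν₀ > 0, ∀ ν ∈ (0, ν₀), c ≤ A_T(ν) := ∫₀^∞ e^{-νt} C_T(t) dt`.

S7 is NOT proved here (it is open: the Fermi-golden-rule value of the transport plateau needs the
kinetic limit). What this file machine-checks is the **Fejér–Poisson reduction**
`stub_fgrPositivity_of_cesaroFloor`: S7 follows — same parameters, same `T₀`, same framework
hypotheses — from the time-domain CESÀRO form the kinetic theory naturally delivers,

  (CESÀRO) `∃ c τ₀ > 0, ∀ τ > τ₀, c ≤ ∫₀^τ (1 - t/τ) C_T(t) dt`,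

a uniform positive floor of the Fejér means of `C_T`; precisely `A_T(ν) ≥ ¼ ∫₀^{1/ν} (1 - νt) C_T(t) dt`
for every `ν > 0`, so S7 holds with `c/4` and `ν₀ = 1/τ₀`.

Proof (all classical, `[folklore]`):
1. Under the framework hypotheses `C_T` is continuous (strong continuity of the Koopman group,
   `ZeroWavenumberData.inner_currentClass_koopman_eq_currentCorrelation'`), even
   (`ZeroWavenumberData.currentCorrelation_neg`) and positive semidefinite
   (`ZeroWavenumberData.sum_mul_currentCorrelation_nonneg`); by the landed cosine Bochner theorem
   `stub_cosineBochner`, `C_T(t) = ∫ cos(xt) dσ(x)` for a finite measure `σ`.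
2. Abel side (landed, `AbelOfSpectralDensity.integral_exp_neg_mul_cosTransform`):
   `A_T(ν) = ∫ ν/(ν² + x²) dσ(x)`.
3. Fejér side (`integral_one_sub_div_mul_cosTransform`, Fubini on `(0, τ] × ℝ`):
   `∫₀^τ (1 - t/τ) C_T(t) dt = ∫ k_τ(x) dσ(x)` with the Fejér kernel
   `k_τ(x) = ∫₀^τ (1 - t/τ) cos(xt) dt = (1 - cos(xτ))/(τx²)` (`x ≠ 0`), `k_τ(0) = τ/2`
   (`integral_one_sub_div_mul_cos`, `integral_one_sub_div_mul_cos_zero`).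
4. Kernel domination (`integral_one_sub_div_mul_cos_le_four_mul_poisson`): for `τ = 1/ν`,
   `0 ≤ k_τ(x) ≤ 4ν/(ν² + x²)`, from the one-variable inequality `(1 - cos y)(1 + y²) ≤ 4y²`
   (`one_sub_cos_mul_one_add_sq_le`: `1 - cos ≤ 2` for `|y| ≥ 1`, `1 - cos y ≤ y²/2` for `|y| < 1`).
5. Hence `∫₀^{1/ν} (1 - νt) C_T ≤ 4 A_T(ν)` (`fejerMean_le_four_mul_abelMean`) and the floor transfers.
-/

noncomputable section

namespace Summit.AtomisticToContinuum.FouriersLaw.Theorems.MourreDissolution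

open MeasureTheory Set Filter Topology
open Literature.MathematicalPhysics.KineticTheory.HeatConduction
open Literature.MathematicalPhysics.KineticTheory
open Summit.AtomisticToContinuum.FouriersLaw.Theorems.AbelOfSpectralDensity
  (integral_exp_neg_mul_cosTransform)

/-! ### 1. The elementary inequality `(1 - cos y)(1 + y²) ≤ 4y²` -/

/-- `(1 - cos y)(1 + y²) ≤ 4y²` for every real `y`: if `y² ≥ 1` then `1 - cos y ≤ 2` and
`2(1 + y²) ≤ 4y²`; if `y² < 1` then `1 - cos y ≤ y²/2` (`Real.one_sub_sq_div_two_le_cos`) and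
`(y²/2)(1 + y²) ≤ y²`. [folklore] -/
theorem one_sub_cos_mul_one_add_sq_le (y : ℝ) : (1 - Real.cos y) * (1 + y ^ 2) ≤ 4 * y ^ 2 := by
  have h0 : 0 ≤ 1 - Real.cos y := sub_nonneg.2 (Real.cos_le_one y)
  have h2 : 1 - Real.cos y ≤ 2 := by linarith [Real.neg_one_le_cos y]
  rcases le_or_gt 1 (y ^ 2) with hy | hy
  · calc (1 - Real.cos y) * (1 + y ^ 2) ≤ 2 * (1 + y ^ 2) :=
          mul_le_mul_of_nonneg_right h2 (by positivity)
      _ ≤ 4 * y ^ 2 := by linarith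
  · have hc : 1 - Real.cos y ≤ y ^ 2 / 2 := by
      linarith [Real.one_sub_sq_div_two_le_cos (x := y)]
    calc (1 - Real.cos y) * (1 + y ^ 2) ≤ (1 - Real.cos y) * 2 :=
          mul_le_mul_of_nonneg_left (by linarith) h0
      _ ≤ y ^ 2 := by linarith
      _ ≤ 4 * y ^ 2 := by linarith [sq_nonneg y]

/-! ### 2. The Fejér kernel `k_τ(x) = ∫₀^τ (1 - t/τ) cos(xt) dt` -/

/-- The Fejér kernel off the origin: for `τ ≠ 0` and `x ≠ 0`,
`∫₀^τ (1 - t/τ) cos(xt) dt = (1 - cos(xτ))/(τx²)`, by the primitive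
`t ↦ (1 - t/τ) sin(xt)/x - cos(xt)/(τx²)`. [folklore] -/
theorem integral_one_sub_div_mul_cos {τ x : ℝ} (hτ : τ ≠ 0) (hx : x ≠ 0) :
    ∫ t in (0:ℝ)..τ, (1 - t / τ) * Real.cos (x * t) = (1 - Real.cos (x * τ)) / (τ * x ^ 2) := by
  have hderiv : ∀ t ∈ uIcc (0:ℝ) τ, HasDerivAt
      (fun t : ℝ => (1 - t / τ) * Real.sin (x * t) / x - Real.cos (x * t) / (τ * x ^ 2))
      ((1 - t / τ) * Real.cos (x * t)) t := by
    intro t _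
    have hl : HasDerivAt (fun t : ℝ => x * t) (x * 1) t := (hasDerivAt_id' t).const_mul x
    have ha : HasDerivAt (fun t : ℝ => 1 - t / τ) (-(1 / τ)) t :=
      ((hasDerivAt_id' t).div_const τ).const_sub 1
    refine (((ha.mul hl.sin).div_const x).sub (hl.cos.div_const (τ * x ^ 2))).congr_deriv ?_
    field_simp
    ring
  rw [intervalIntegral.integral_eq_sub_of_hasDerivAt hderiv
    ((by fun_prop : Continuous fun t : ℝ => (1 - t / τ) * Real.cos (x * t)).intervalIntegrable
      0 τ)]
  simp only [mul_zero, Real.sin_zero, Real.cos_zero, div_self hτ, sub_self, zero_mul, zero_div,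
    zero_sub, sub_zero]
  field_simp
  ring

/-- The Fejér kernel at the origin: `∫₀^τ (1 - t/τ) cos(0·t) dt = τ/2` for `τ ≠ 0`. [folklore] -/
theorem integral_one_sub_div_mul_cos_zero {τ : ℝ} (hτ : τ ≠ 0) :
    ∫ t in (0:ℝ)..τ, (1 - t / τ) * Real.cos (0 * t) = τ / 2 := by
  simp only [zero_mul, Real.cos_zero, mul_one]
  rw [intervalIntegral.integral_sub intervalIntegrable_const
      ((by fun_prop : Continuous fun t : ℝ => t / τ).intervalIntegrable 0 τ),
    intervalIntegral.integral_const, intervalIntegral.integral_div, integral_id]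
  field_simp
  ring

/-- The Fejér kernel is non-negative: `0 ≤ ∫₀^τ (1 - t/τ) cos(xt) dt` for `τ > 0`. [folklore] -/
theorem integral_one_sub_div_mul_cos_nonneg {τ : ℝ} (hτ : 0 < τ) (x : ℝ) :
    0 ≤ ∫ t in (0:ℝ)..τ, (1 - t / τ) * Real.cos (x * t) := by
  rcases eq_or_ne x 0 with rfl | hx
  · rw [integral_one_sub_div_mul_cos_zero hτ.ne']
    positivity
  · rw [integral_one_sub_div_mul_cos hτ.ne' hx]
    exact div_nonneg (sub_nonneg.2 (Real.cos_le_one _)) (by positivity)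

/-- **Fejér–Poisson kernel domination.** For `ν > 0` and `τ = ν⁻¹`:
`∫₀^τ (1 - t/τ) cos(xt) dt ≤ 4ν/(ν² + x²)` for every `x` (at `x = 0`: `1/(2ν) ≤ 4/ν`; for
`x ≠ 0` it is `(1 - cos y)(1 + y²) ≤ 4y²` at `y = x/ν`, scaled by `ν²`). [folklore] -/
theorem integral_one_sub_div_mul_cos_le_four_mul_poisson {ν : ℝ} (hν : 0 < ν) (x : ℝ) :
    ∫ t in (0:ℝ)..ν⁻¹, (1 - t / ν⁻¹) * Real.cos (x * t) ≤ 4 * (ν / (ν ^ 2 + x ^ 2)) := by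
  have hν' : ν ≠ 0 := hν.ne'
  have hτ : (0:ℝ) < ν⁻¹ := inv_pos.2 hν
  rcases eq_or_ne x 0 with rfl | hx
  · rw [integral_one_sub_div_mul_cos_zero hτ.ne']
    have h : ν / (ν ^ 2 + (0:ℝ) ^ 2) = ν⁻¹ := by
      field_simp
      ring
    rw [h]
    linarith
  · rw [integral_one_sub_div_mul_cos hτ.ne' hx, ← mul_div_assoc,
      div_le_div_iff₀ (by positivity) (by positivity)]
    have key := one_sub_cos_mul_one_add_sq_le (x * ν⁻¹)
    have h := mul_le_mul_of_nonneg_right key (sq_nonneg ν)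
    calc (1 - Real.cos (x * ν⁻¹)) * (ν ^ 2 + x ^ 2)
        = (1 - Real.cos (x * ν⁻¹)) * (1 + (x * ν⁻¹) ^ 2) * ν ^ 2 := by
          field_simp
      _ ≤ 4 * (x * ν⁻¹) ^ 2 * ν ^ 2 := h
      _ = 4 * ν * (ν⁻¹ * x ^ 2) := by
          field_simp

/-! ### 3. Fubini on the Fejér side and the comparison of means -/

/-- The Poisson kernel `x ↦ ν/(ν² + x²)` (`ν > 0`) is integrable against a finite measure.
[folklore] -/
theorem integrable_poissonKernel' (σ : Measure ℝ) [IsFiniteMeasure σ] {ν : ℝ} (hν : 0 < ν) :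
    Integrable (fun x : ℝ => ν / (ν ^ 2 + x ^ 2)) σ := by
  refine integrable_of_continuous_of_norm_le σ
    (continuous_const.div (by fun_prop) fun x => by positivity) (M := ν / ν ^ 2) fun x => ?_
  rw [add_comm]
  exact norm_poisson_le hν x

/-- **Fejér side of the spectral representation.** For a finite measure `σ` with cosine transform
`C` and `τ ≥ 0`: `∫₀^τ (1 - t/τ) C(t) dt = ∫ (∫₀^τ (1 - t/τ) cos(xt) dt) dσ(x)` (Fubini on
`(0, τ] × ℝ`, the integrand being dominated by `|1 - t/τ|`). [folklore] -/
theorem integral_one_sub_div_mul_cosTransform (σ : Measure ℝ) [IsFiniteMeasure σ] {C : ℝ → ℝ}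
    (hC : ∀ t : ℝ, C t = ∫ x, Real.cos (x * t) ∂σ) {τ : ℝ} (hτ : 0 ≤ τ) :
    ∫ t in (0:ℝ)..τ, (1 - t / τ) * C t =
      ∫ x, (∫ t in (0:ℝ)..τ, (1 - t / τ) * Real.cos (x * t)) ∂σ := by
  have hint : Integrable (Function.uncurry fun (t x : ℝ) => (1 - t / τ) * Real.cos (x * t))
      ((volume.restrict (Set.uIoc 0 τ)).prod σ) := by
    rw [Set.uIoc_of_le hτ]
    simp only [Function.uncurry_def]
    have h1 : Integrable (fun t : ℝ => 1 - t / τ) (volume.restrict (Ioc 0 τ)) :=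
      (by fun_prop : Continuous fun t : ℝ => 1 - t / τ).integrableOn_Ioc
    have h2 : Integrable (fun z : ℝ × ℝ => (1 - z.1 / τ) * (1:ℝ))
        ((volume.restrict (Ioc 0 τ)).prod σ) := h1.mul_prod (integrable_const 1)
    refine h2.mono (Continuous.aestronglyMeasurable (by fun_prop)) (ae_of_all _ fun z => ?_)
    rw [norm_mul, norm_mul, norm_one, mul_one]
    exact mul_le_of_le_one_right (norm_nonneg _) (by simpa using Real.abs_cos_le_one _)
  calc ∫ t in (0:ℝ)..τ, (1 - t / τ) * C t
      = ∫ t in (0:ℝ)..τ, ∫ x, (1 - t / τ) * Real.cos (x * t) ∂σ := by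
        refine intervalIntegral.integral_congr fun t _ => ?_
        rw [hC t, integral_const_mul]
    _ = ∫ x, (∫ t in (0:ℝ)..τ, (1 - t / τ) * Real.cos (x * t)) ∂σ :=
        intervalIntegral_integral_swap hint

/-- **Cesàro ≤ 4 · Abel.** For a finite measure `σ` with cosine transform `C` and `ν > 0`:
`∫₀^{1/ν} (1 - νt) C(t) dt ≤ 4 ∫_{t>0} e^{-νt} C(t) dt` (spectral representations of both sides
and the kernel domination `integral_one_sub_div_mul_cos_le_four_mul_poisson`). [folklore] -/
theorem fejerMean_le_four_mul_abelMean (σ : Measure ℝ) [IsFiniteMeasure σ] {C : ℝ → ℝ}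
    (hC : ∀ t : ℝ, C t = ∫ x, Real.cos (x * t) ∂σ) {ν : ℝ} (hν : 0 < ν) :
    ∫ t in (0:ℝ)..ν⁻¹, (1 - t / ν⁻¹) * C t ≤
      4 * ∫ t in Ioi (0:ℝ), Real.exp (-(ν * t)) * C t := by
  have hτ : (0:ℝ) ≤ ν⁻¹ := (inv_pos.2 hν).le
  have hA : ∫ t in Ioi (0:ℝ), Real.exp (-(ν * t)) * C t = ∫ x, ν / (ν ^ 2 + x ^ 2) ∂σ := by
    rw [← integral_exp_neg_mul_cosTransform σ hν]
    refine setIntegral_congr_fun measurableSet_Ioi fun t _ => ?_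
    rw [hC t]
  rw [integral_one_sub_div_mul_cosTransform σ hC hτ, hA, ← integral_const_mul]
  exact integral_mono_of_nonneg (ae_of_all _ fun x => integral_one_sub_div_mul_cos_nonneg (inv_pos.2 hν) x)
    ((integrable_poissonKernel' σ hν).const_mul 4)
    (ae_of_all _ fun x => integral_one_sub_div_mul_cos_le_four_mul_poisson hν x)

/-! ### 4. The reduction of Stub 7 to a Cesàro floor -/

/-- **Headline (registered helper stub of `stmt-AtomisticToContinuum-12594`): a Cesàro floor of the
current autocorrelation implies Stub 7.** If under the hypotheses of `stub_fgrPositivity` there are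
`c τ₀ > 0` with `c ≤ ∫₀^τ (1 - t/τ) C_T(t) dt` for all `τ > τ₀` (a uniform positive floor of the
Fejér means of `C_T = D.currentCorrelation Z.μ`), then the registered conclusion of
`stub_fgrPositivity` holds with the same `T₀` and the constants `c/4`, `ν₀ = τ₀⁻¹`: by
`stub_cosineBochner` (continuity, evenness and positive semidefiniteness of `C_T` from
`ZeroWavenumberSpace`) `C_T` is the cosine transform of a finite measure, and then
`∫₀^{1/ν} (1 - νt) C_T ≤ 4 ∫₀^∞ e^{-νt} C_T` (`fejerMean_le_four_mul_abelMean`). [folklore] -/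
theorem stub_fgrPositivity_of_cesaroFloor :
    (∀ ω₂ lam β γ : ℝ, 0 < ω₂ → 0 < lam → 0 < β → 0 < γ →
      Literature.MathematicalPhysics.KineticTheory.PhononBoltzmann.HasOddSectorGap ω₂ lam β →
      ∃ T₀ : ℝ, 0 < T₀ ∧ ∀ T : ℝ, 0 < T → T < T₀ →
        ∀ (D : Literature.MathematicalPhysics.KineticTheory.HeatConduction.InfiniteChainDynamics
            (Literature.MathematicalPhysics.KineticTheory.HeatConduction.pinnedChain ω₂ lam β γ))
          (Z : Literature.MathematicalPhysics.KineticTheory.HeatConduction.ZeroWavenumberData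
            (Literature.MathematicalPhysics.KineticTheory.HeatConduction.pinnedChain ω₂ lam β γ) D),
          D.carrier =
              (Literature.MathematicalPhysics.KineticTheory.HeatConduction.pinnedChain
                ω₂ lam β γ).bmGood →
          (Literature.MathematicalPhysics.KineticTheory.HeatConduction.pinnedChain
              ω₂ lam β γ).IsChainGibbsMeasure T Z.μ →
          (Literature.MathematicalPhysics.KineticTheory.HeatConduction.pinnedChain
              ω₂ lam β γ).HasSuperstabilityEstimate Z.μ →
          Z.HasMomentumReversal →
          (∀ ψ : Literature.MathematicalPhysics.KineticTheory.HeatConduction.ZeroWavenumberSpace Z,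
            Continuous fun t : ℝ => Z.koopman t ψ) →
          ∃ c τ₀ : ℝ, 0 < c ∧ 0 < τ₀ ∧ ∀ τ : ℝ, τ₀ < τ →
            c ≤ intervalIntegral (fun t : ℝ => (1 - t / τ) * D.currentCorrelation Z.μ t) 0 τ
              MeasureTheory.volume) →
    ∀ ω₂ lam β γ : ℝ, 0 < ω₂ → 0 < lam → 0 < β → 0 < γ →
      Literature.MathematicalPhysics.KineticTheory.PhononBoltzmann.HasOddSectorGap ω₂ lam β →
      ∃ T₀ : ℝ, 0 < T₀ ∧ ∀ T : ℝ, 0 < T → T < T₀ →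
        ∀ (D : Literature.MathematicalPhysics.KineticTheory.HeatConduction.InfiniteChainDynamics
            (Literature.MathematicalPhysics.KineticTheory.HeatConduction.pinnedChain ω₂ lam β γ))
          (Z : Literature.MathematicalPhysics.KineticTheory.HeatConduction.ZeroWavenumberData
            (Literature.MathematicalPhysics.KineticTheory.HeatConduction.pinnedChain ω₂ lam β γ) D),
          D.carrier =
              (Literature.MathematicalPhysics.KineticTheory.HeatConduction.pinnedChain
                ω₂ lam β γ).bmGood →
          (Literature.MathematicalPhysics.KineticTheory.HeatConduction.pinnedChain
              ω₂ lam β γ).IsChainGibbsMeasure T Z.μ →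
          (Literature.MathematicalPhysics.KineticTheory.HeatConduction.pinnedChain
              ω₂ lam β γ).HasSuperstabilityEstimate Z.μ →
          Z.HasMomentumReversal →
          (∀ ψ : Literature.MathematicalPhysics.KineticTheory.HeatConduction.ZeroWavenumberSpace Z,
            Continuous fun t : ℝ => Z.koopman t ψ) →
          ∃ c ν₀ : ℝ, 0 < c ∧ 0 < ν₀ ∧ ∀ ν : ℝ, 0 < ν → ν < ν₀ →
            c ≤ MeasureTheory.integral (MeasureTheory.volume.restrict (Set.Ioi (0:ℝ)))
              (fun t : ℝ => Real.exp (-(ν * t)) * D.currentCorrelation Z.μ t) := by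
  intro hCes ω₂ lam β γ hω₂ hlam hβ hγ hH
  obtain ⟨T₀, hT₀, hT⟩ := hCes ω₂ lam β γ hω₂ hlam hβ hγ hH
  refine ⟨T₀, hT₀, fun T hTpos hTlt D Z hcar hGibbs hSS hRev hsc => ?_⟩
  obtain ⟨c, τ₀, hc, hτ₀, hfloor⟩ := hT T hTpos hTlt D Z hcar hGibbs hSS hRev hsc
  -- `C_T` is continuous, even and positive semidefinite, hence a cosine transform (Stub 2)
  have hCcont : Continuous (D.currentCorrelation Z.μ) :=
    (continuous_const.inner (hsc Z.currentClass)).congr fun t =>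
      Z.inner_currentClass_koopman_eq_currentCorrelation' hRev t
  have hCeven : ∀ t : ℝ, D.currentCorrelation Z.μ (-t) = D.currentCorrelation Z.μ t :=
    fun t => Z.currentCorrelation_neg hRev t
  have hCpsd : ∀ (n : ℕ) (a s : Fin n → ℝ),
      0 ≤ ∑ i, ∑ j, a i * a j * D.currentCorrelation Z.μ (s j - s i) :=
    fun n a s => Z.sum_mul_currentCorrelation_nonneg hRev Finset.univ a s
  obtain ⟨σ, hσfin, hσC⟩ := stub_cosineBochner (D.currentCorrelation Z.μ) hCcont hCeven hCpsd
  haveI := hσfin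
  -- the floor transfers with `c/4` and `ν₀ = τ₀⁻¹`
  refine ⟨c / 4, τ₀⁻¹, by positivity, inv_pos.2 hτ₀, fun ν hν hνlt => ?_⟩
  have hτ : τ₀ < ν⁻¹ := (lt_inv_comm₀ hν hτ₀).1 hνlt
  have h1 := hfloor ν⁻¹ hτ
  have h2 := fejerMean_le_four_mul_abelMean σ hσC hν
  change c / 4 ≤ ∫ t in Ioi (0:ℝ), Real.exp (-(ν * t)) * D.currentCorrelation Z.μ t
  linarith

end Summit.AtomisticToContinuum.FouriersLaw.Theorems.MourreDissolution

end
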